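import Summits.Ventures.PercRepro.RankLevelSetExplicitLin2KeyL

/-!
# PercRepro — THE LEVEL-11 THEOREM-M ROW OF C-025 (SHARP): THE KEY AT `p = 2 236` (p4, S4 feed)

`proofs/P4-gen18.md`. With THEOREM M's staircase multiplicity the assembled inequality `(P_d)` holds, exactly evaluated, at EVERY
core corank `12 ≤ d ≤ 2059` from `p = 1 555` (it fails at `p = 1 554`, corank `1 085`; the quartic floor is `4 309`, the
saturated one `18 780`). The row is taken at `p = 2 236` = the optimal-Chernoff tail (the least `p` with `16·n^n ≤ 2^n·(n − K)^{n−K}·K^K` at `n = p + D`, `K = 11 + D`, `D = 11 + 2^11`) of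
RankLevelSetExplicitLin2TailOptimal, which now binds: the key `KeyL 11 2236 d` (RankLevelSetExplicitLin2KeyL) is checked by the kernel at the
2 048 coranks (`decide`, 1 chunk of 2 048). The level step and the unconditional chain are
RankLevelSetExplicitLin2IndepFloorS (`c025_eleven_indepS_step`, `c025_eleven_indepS_from_2236`). Axioms: standard.
-/

namespace PercRepro

namespace ThmN

namespace Explicit

/-- **THE THEOREM-M KEY ROW AT `(q, p) = (11, 2 236)`**: `KeyL 11 2236 d` at every corank `12 ≤ d ≤ 2059`, by the kernel. -/
theorem key_eleven_indepS_row : ∀ t < 2048, KeyL 11 2236 (12 + t) := by decide +kernel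

end Explicit

end ThmN

end PercRepro
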